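import Mathlib
import Literature.RepresentationTheory.Semisimple.EquivOfCharacter
import Literature.RepresentationTheory.Semisimple.Twist
import Literature.RepresentationTheory.Semisimple.Multiplicity
import Literature.RepresentationTheory.Semisimple.FinTwoSemisimplification
import HarnessLib

/-!
# Reducible rank-2 representations and the diagonal rank-3 model `1 ⊕ μ ⊕ μ⁻¹`

Helper file for the item `EssSelfDualIrreducibleCM` (stmt-Langlands-13618) of the route
`IrreducibilityBySelfDuality` (the case "`ρ_σ` reducible" of the Schur step):
* `exists_characters_of_not_isIrreducible` — a reducible `ρ : Γ → GL₂(k)` has trace `χ₁ + χ₂` for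
  two characters (`χ₁` the eigencharacter of a stable line, `χ₂ = det ρ / χ₁`, Cayley–Hamilton);
* `exists_diagonal_three` — the semisimple representation `diag(1, μ, μ⁻¹)` on `k³`, its character
  `1 + μ + μ⁻¹` and its three stable coordinate lines;
* `exists_three_eigenlines_of_character_eq` — Brauer–Nesbitt: a SEMISIMPLE representation with
  character `1 + μ + μ⁻¹` (char. `0`) has three linearly independent common eigenvectors.
-/

noncomputable section

set_option linter.dupNamespace false -- project-wide option (lakefile weak.linter.dupNamespace); `Summit.Langlands.Langlands` is the mandated namespace

open Matrix
open Literature.RepresentationTheory.Semisimple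

namespace Summit.Langlands.Langlands.Theorems.EssSelfDualIrreducibleCM

variable {k : Type*} [Field k] {Γ : Type*} [Group Γ]

/-! ### A reducible rank-2 representation has trace `χ₁ + χ₂` -/

/-- **A reducible `ρ : Γ → GL₂(k)` has abelian trace**: if the representation of `Γ` on `k²` through
`ρ` is not irreducible, there are characters `χ₁, χ₂ : Γ → kˣ` with `tr ρ(g) = χ₁(g) + χ₂(g)` for all
`g` (`χ₁` = the eigencharacter on a stable line `k w`, `χ₂ = det ρ · χ₁⁻¹`; `χ₁(g)` is a root of
`X² - tr ρ(g) X + det ρ(g)` by Cayley–Hamilton).  Curtis–Reiner I §16B; the tree's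
`exists_semisimplification_fin_two`. [folklore] -/
theorem exists_characters_of_not_isIrreducible (ρ : Γ →* GL (Fin 2) k)
    (hirr : ¬ Representation.IsIrreducible
      ((Representation.ofDistribMulAction k (GL (Fin 2) k) (Fin 2 → k)).comp ρ)) :
    ∃ χ₁ χ₂ : Γ →* kˣ, ∀ g, ((ρ g : GL (Fin 2) k) : Matrix (Fin 2) (Fin 2) k).trace =
      (χ₁ g : k) + (χ₂ g : k) := by
  classical
  set R := (Representation.ofDistribMulAction k (GL (Fin 2) k) (Fin 2 → k)).comp ρ with hR
  have hRapply : ∀ (g : Γ) (v : Fin 2 → k),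
      R g v = ((ρ g : GL (Fin 2) k) : Matrix (Fin 2) (Fin 2) k) *ᵥ v := fun _ _ ↦ rfl
  -- a stable line `k w`
  have hbot : (⊥ : Subrepresentation R).toSubmodule = ⊥ := rfl
  have htop : (⊤ : Subrepresentation R).toSubmodule = ⊤ := rfl
  have hbt : (⊥ : Subrepresentation R) ≠ ⊤ := by
    intro h
    have h' := congrArg Subrepresentation.toSubmodule h
    rw [hbot, htop] at h'
    exact bot_ne_top h'
  obtain ⟨W, hW0, hW1⟩ : ∃ W : Subrepresentation R, W ≠ ⊥ ∧ W ≠ ⊤ := by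
    by_contra hcon
    push Not at hcon
    haveI : Nontrivial (Subrepresentation R) := ⟨⟨⊥, ⊤, hbt⟩⟩
    exact hirr ⟨fun W ↦ or_iff_not_imp_left.mpr (hcon W)⟩
  have hW0' : W.toSubmodule ≠ ⊥ := fun h ↦ hW0 (Subrepresentation.toSubmodule_injective
    (by rw [h, hbot]))
  have hW1' : W.toSubmodule ≠ ⊤ := fun h ↦ hW1 (Subrepresentation.toSubmodule_injective
    (by rw [h, htop]))
  have hWrank : Module.finrank k W.toSubmodule = 1 := finrank_eq_one_of_ne_bot_of_ne_top hW0' hW1'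
  obtain ⟨w, hwW, hw0⟩ := Submodule.exists_mem_ne_zero_of_ne_bot hW0'
  have hmult : ∀ v ∈ W.toSubmodule, ∃ c : k, c • w = v := by
    intro v hv
    obtain ⟨c, hc⟩ := (finrank_eq_one_iff_of_nonzero' (⟨w, hwW⟩ : W.toSubmodule)
      (by exact_mod_cast Subtype.coe_ne_coe.mp hw0 : (⟨w, hwW⟩ : W.toSubmodule) ≠ 0)).mp hWrank ⟨v, hv⟩
    exact ⟨c, by simpa using congrArg Subtype.val hc⟩
  -- the eigencharacter `χ₁`
  have hex : ∀ g : Γ, ∃ c : k, c • w = R g w := fun g ↦ hmult _ (W.apply_mem_toSubmodule g hwW)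
  choose χ hχ using hex
  have hχne : ∀ g, χ g ≠ 0 := by
    intro g hg
    have h1 : R g w = 0 := by rw [← hχ g, hg, zero_smul]
    have h2 : w = 0 := by
      have := congrArg (R g⁻¹) h1
      rwa [map_zero, ← Module.End.mul_apply, ← map_mul, inv_mul_cancel, map_one,
        Module.End.one_apply] at this
    exact hw0 h2
  have hχmul : ∀ g h, χ (g * h) = χ g * χ h := by
    intro g h
    apply smul_left_injective k hw0
    change χ (g * h) • w = (χ g * χ h) • w
    rw [hχ, map_mul, Module.End.mul_apply, ← hχ h, map_smul, ← hχ g, smul_smul, mul_comm]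
  have hχone : χ 1 = 1 := by
    apply smul_left_injective k hw0
    change χ 1 • w = (1 : k) • w
    rw [hχ, map_one, Module.End.one_apply, one_smul]
  let χ₁ : Γ →* kˣ :=
    { toFun := fun g ↦ Units.mk0 (χ g) (hχne g)
      map_one' := Units.ext hχone
      map_mul' := fun g h ↦ Units.ext (hχmul g h) }
  have hχ₁ : ∀ g, ((χ₁ g : kˣ) : k) = χ g := fun _ ↦ rfl
  -- `χ₂ = det / χ₁`
  let δ : Γ →* kˣ := Matrix.GeneralLinearGroup.det.comp ρ
  have hδ : ∀ g, ((δ g : kˣ) : k) = ((ρ g : GL (Fin 2) k) : Matrix (Fin 2) (Fin 2) k).det :=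
    fun _ ↦ rfl
  refine ⟨χ₁, δ * χ₁⁻¹, fun g ↦ ?_⟩
  -- Cayley–Hamilton on the eigenvector: `χ(g)² - tr χ(g) + det = 0`
  have hroot : χ g ^ 2 - ((ρ g : GL (Fin 2) k) : Matrix (Fin 2) (Fin 2) k).trace * χ g +
      ((ρ g : GL (Fin 2) k) : Matrix (Fin 2) (Fin 2) k).det = 0 :=
    sq_sub_trace_mul_add_det_eq_zero hw0 (by rw [← hRapply, ← hχ g])
  have h2 : (((δ * χ₁⁻¹) g : kˣ) : k) = ((ρ g : GL (Fin 2) k) : Matrix (Fin 2) (Fin 2) k).det * (χ g)⁻¹ := by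
    simp [hδ, hχ₁]
  rw [hχ₁, h2]
  have hinv : χ g * (χ g)⁻¹ = 1 := mul_inv_cancel₀ (hχne g)
  linear_combination (-(χ g)⁻¹) * hroot +
    (χ g - ((ρ g : GL (Fin 2) k) : Matrix (Fin 2) (Fin 2) k).trace) * hinv

/-! ### One-dimensional representations are irreducible -/

/-- A representation on a one-dimensional space is irreducible (its only subrepresentations are
`⊥ ≠ ⊤`). [folklore] -/
theorem isIrreducible_of_finrank_eq_one {V : Type*} [AddCommGroup V] [Module k V]
    (hV : Module.finrank k V = 1) (τ : Representation k Γ V) : τ.IsIrreducible := by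
  haveI hs : IsSimpleModule k V := isSimpleModule_iff_finrank_eq_one.2 hV
  have hinj := Subrepresentation.toSubmodule_injective (ρ := τ)
  have hbot : (⊥ : Subrepresentation τ).toSubmodule = ⊥ := rfl
  have htop : (⊤ : Subrepresentation τ).toSubmodule = ⊤ := rfl
  haveI : Nontrivial (Subrepresentation τ) := ⟨⟨⊥, ⊤, fun e => by
    have := congrArg Subrepresentation.toSubmodule e
    rw [hbot, htop] at this
    exact bot_ne_top this⟩⟩
  exact ⟨fun U => by
    rcases eq_bot_or_eq_top U.toSubmodule with hU | hU
    · exact Or.inl (hinj (hU.trans hbot.symm))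
    · exact Or.inr (hinj (hU.trans htop.symm))⟩

/-! ### The diagonal model `1 ⊕ μ ⊕ μ⁻¹` on `k³` -/

/-- **The semisimple representation `diag(1, μ, μ⁻¹)` on `k³`.**  For a character `μ : Γ → kˣ` there
is a semisimple representation `D` of `Γ` on `k³` with character `1 + μ + μ⁻¹` whose three coordinate
lines are stable: `D(g) eᵢ = dᵢ(g) eᵢ` (`d = (1, μ, μ⁻¹)`).  (The product of the three one-dimensional,
hence irreducible, representations `1, μ, μ⁻¹`; semisimple as a finite product of simple
`k[Γ]`-modules.) [folklore] -/
theorem exists_diagonal_three (μ : Γ →* kˣ) :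
    ∃ D : Representation k Γ (Fin 3 → k), D.IsSemisimpleRepresentation ∧
      (∀ g, D.character g = 1 + (μ g : k) + ((μ g)⁻¹ : kˣ)) ∧
      ∀ (g : Γ) (i : Fin 3), ∃ c : k, D g (Pi.single i 1) = c • Pi.single i 1 := by
  classical
  let d : Fin 3 → (Γ →* kˣ) := ![1, μ, μ⁻¹]
  let τ : ∀ _ : Fin 3, Representation k Γ k := fun j =>
    Literature.RepresentationTheory.Semisimple.Representation.twist (Representation.trivial k Γ k) (d j)
  have hτ : ∀ j g (x : k), τ j g x = ((d j g : kˣ) : k) * x := fun j g x => by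
    simp only [τ, Literature.RepresentationTheory.Semisimple.Representation.twist_apply_apply,
      Representation.trivial_apply, smul_eq_mul]
  let D : Representation k Γ (Fin 3 → k) := Literature.RepresentationTheory.Semisimple.Representation.pi τ
  have hD : ∀ g v j, D g v j = ((d j g : kˣ) : k) * v j := fun g v j => by
    change Literature.RepresentationTheory.Semisimple.Representation.pi τ g v j = _
    rw [Literature.RepresentationTheory.Semisimple.Representation.pi_apply_apply, hτ]
  have hDsingle : ∀ (g : Γ) (i : Fin 3), D g (Pi.single i 1) = ((d i g : kˣ) : k) • Pi.single i 1 := by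
    intro g i
    ext j
    rw [hD, Pi.smul_apply, smul_eq_mul]
    by_cases hij : j = i
    · subst hij; rfl
    · rw [Pi.single_eq_of_ne hij, mul_zero, mul_zero]
  refine ⟨D, ?_, fun g => ?_, fun g i => ⟨_, hDsingle g i⟩⟩
  · -- semisimplicity: `D.asModule ≅ Π_j (τ j).asModule`, each factor simple
    haveI : ∀ j, (τ j).IsIrreducible := fun j =>
      isIrreducible_of_finrank_eq_one (Module.finrank_self k) (τ j)
    haveI : ∀ j, IsSemisimpleModule (MonoidAlgebra k Γ) (τ j).asModule := fun j =>
      (Representation.isSemisimpleRepresentation_iff_isSemisimpleModule_asModule (τ j)).mp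
        inferInstance
    rw [Representation.isSemisimpleRepresentation_iff_isSemisimpleModule_asModule]
    exact IsSemisimpleModule.congr (Literature.RepresentationTheory.Semisimple.Representation.piAsModuleEquiv τ)
  · -- the character
    change LinearMap.trace k (Fin 3 → k) (D g) = _
    rw [LinearMap.trace_eq_matrix_trace k (Pi.basisFun k (Fin 3)), Matrix.trace, Fin.sum_univ_three]
    simp only [Matrix.diag_apply, LinearMap.toMatrix_apply, Pi.basisFun_repr, Pi.basisFun_apply, hDsingle,
      Pi.smul_apply, Pi.single_eq_same, smul_eq_mul, mul_one]
    simp [d]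

/-! ### Brauer–Nesbitt: three common eigen-lines from the character `1 + μ + μ⁻¹` -/

/-- **Three stable lines from the character.**  Over a field of characteristic `0`, a SEMISIMPLE
finite-dimensional representation `R` whose character is `1 + μ + μ⁻¹` for a character `μ : Γ → kˣ`
is equivalent to `diag(1, μ, μ⁻¹)` (Brauer–Nesbitt for semisimple representations,
`nonempty_equiv_of_character_eq_of_isSemisimple`, Bourbaki A VIII §20 n°6), hence has three linearly
independent common eigenvectors of `Γ`. [folklore] -/
theorem exists_three_eigenlines_of_character_eq [CharZero k] {V : Type*} [AddCommGroup V] [Module k V]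
    [FiniteDimensional k V] (R : Representation k Γ V) [R.IsSemisimpleRepresentation] (μ : Γ →* kˣ)
    (hchar : ∀ g, R.character g = 1 + (μ g : k) + ((μ g)⁻¹ : kˣ)) :
    ∃ x : Fin 3 → V, LinearIndependent k x ∧ ∀ (i : Fin 3) (g : Γ), ∃ c : k, R g (x i) = c • x i := by
  obtain ⟨D, hDss, hDchar, hDline⟩ := exists_diagonal_three μ
  haveI := hDss
  obtain ⟨e⟩ := Literature.RepresentationTheory.Semisimple.Representation.nonempty_equiv_of_character_eq_of_isSemisimple
    R D (funext fun g => by rw [hchar, hDchar])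
  refine ⟨fun i => e.symm (Pi.single i 1), ?_, fun i g => ?_⟩
  · have h := (Pi.basisFun k (Fin 3)).linearIndependent.map' e.symm.toLinearEquiv.toLinearMap
      (LinearEquiv.ker _)
    convert h using 1
    funext i
    simp only [Representation.IntertwiningMap.coe_toLinearMap, Representation.Equiv.coe_toIntertwiningMap,
      Function.comp_apply, Pi.basisFun_apply]
    rfl
  · obtain ⟨c, hc⟩ := hDline g i
    refine ⟨c, ?_⟩
    have := Representation.IntertwiningMap.isIntertwining _ _ e.symm.toIntertwiningMap g
      (Pi.single i 1 : Fin 3 → k)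
    rw [hc, map_smul] at this
    exact this.symm

end Summit.Langlands.Langlands.Theorems.EssSelfDualIrreducibleCM

end
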